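import Literature.NumberTheory.Automorphic.RestrictedTensorProductDual
import HarnessLib

/-!
# Twisted coinvariants of a restricted tensor product are non-zero — operator form (the acting group need only act
# coordinatewise on pure tensors)

Topic `NumberTheory/Automorphic`.  Sequel of `RestrictedTensorProductDual.lean` (tree): there, the non-vanishing of the
`χ`-coinvariants `TwistedCoinv.Coinv (π ∘ φ) χ` of a model `(W, j)` of `⊗'_i (V i, x₀ i)` is derived for a group `H`
acting THROUGH the restricted product group `Πʳ i, [G i, K i]` and the representation `⊗' ρ i`
(`IsRestrictedTensorProductRep`).  The proofs use that structure only to know that each `h ∈ H` acts on pure tensors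
COORDINATEWISE.  This file records the statement with exactly that input: a representation `πH` of ANY group `H` on `W`
such that `πH h (j x) = j (A h • x)` for families of local OPERATORS `A h i : V i → V i` fixing the base vectors for
almost all `i` (the tree's `RestrictedFamily.piMap`) — no restricted-product group, no local representations.  This is
the shape in which a CENTRE (e.g. `E¹(𝔸_F^∞)` acting on the finite-adèlic Schwartz–Bruhat model `𝒮((𝔸_{F,f})^N)`,
`piProdSB`) is most cheaply seen to act, and it is what the consumer of [Liu2021] Def. 4.11 / App. D Lem. D.1 (1) at the
genuine ω-carrier pin (χ-coinvariants of the global finite-adèlic Weil representation) needs.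

* `IsRestrictedTensorProduct.prodDual_piMap_apply` — EIGEN-PROPERTY of a product form `Λ` (`exists_prodDual`) under a
  coordinatewise operator `A = (A i)_i`: if `ℓ i ∘ A i = c i · ℓ i` with `c i = 1` for almost all `i`, then
  `Λ (j (A • x)) = (∏_i c i) · Λ (j x)` (Flath 1979, §2: functoriality of `⊗'` on the forms `⊗ λ_v`).
* `IsRestrictedTensorProduct.nontrivial_coinv_of_localEigenfunctionals_of_piMap` — for `πH : Representation k H W` acting
  coordinatewise through operators `A h`, a character `χ : H →* kˣ` with `χ h = ∏_i c h i`, local `A h i`-eigenforms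
  `ℓ i` (eigenvalues `c h i`) normalised at the base vectors off `S₀` and taking the value `1` somewhere on `S₀`:
  `TwistedCoinv.Coinv πH χ` is non-trivial.
* `IsRestrictedTensorProduct.nontrivial_coinv_of_localQuotients_of_piMap` — the same with the local input through
  submodules `N i ≤ V i` containing every `A h i v − c h i • v`: `V i ⧸ N i ≠ 0` on `S₀` (LOCAL NON-VANISHING, [Liu2021]
  App. D Lem. D.1 (1) at the consumer) and `x₀ i ∉ N i` off `S₀` (the unramified vector survives, Def. 4.11 l. 2092)
  suffice (over a field).
* `…_inhabited` — kernel non-vacuity certificate (one-factor trivial product).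

Theorems only; no definition, no named fact, no instance, no `sorry`.

## References

* D. Flath, *Decomposition of representations into tensor products*, Proc. Sympos. Pure Math. 33 (1979), part 1,
  179–183, §2. [Flath1979]
* Y. Liu, *Fourier–Jacobi cycles and arithmetic relative trace formula*, Camb. J. Math. 9 (2021) = arXiv:2102.11518,
  Def. 4.11 (l. 2083–2097), App. D Lem. D.1 (l. 5226–5238) — context only. [Liu2021]
-/

noncomputable section

open scoped RestrictedProduct TensorProduct
open Filter PiTensorProduct Function

namespace Literature.NumberTheory.Automorphic

universe u uk uH v w

section Dual

variable {k : Type uk} [Field k] {V : Type v} [AddCommGroup V] [Module k V]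

/-- If `x ∉ N` there is a linear form killing `N` with value `1` at `x`. [folklore] -/
private theorem exists_dual_vanishing_eq_one' (N : Submodule k V) {x : V} (hx : x ∉ N) :
    ∃ ℓ : V →ₗ[k] k, (∀ n ∈ N, ℓ n = 0) ∧ ℓ x = 1 := by
  have hq : N.mkQ x ≠ 0 := by
    rwa [Ne, Submodule.mkQ_apply, Submodule.Quotient.mk_eq_zero]
  obtain ⟨f, hf⟩ := Module.Projective.exists_dual_eq_one k hq
  refine ⟨f ∘ₗ N.mkQ, fun n hn => ?_, by simpa using hf⟩
  rw [LinearMap.comp_apply, Submodule.mkQ_apply, (Submodule.Quotient.mk_eq_zero N).2 hn, map_zero]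

/-- A proper submodule is killed by some linear form taking the value `1` somewhere. [folklore] -/
private theorem exists_dual_vanishing_of_ne_top' (N : Submodule k V) (hN : N ≠ ⊤) :
    ∃ ℓ : V →ₗ[k] k, (∀ n ∈ N, ℓ n = 0) ∧ ∃ v : V, ℓ v = 1 := by
  obtain ⟨x, hx⟩ : ∃ x : V, x ∉ N := by
    by_contra h
    exact hN (eq_top_iff.2 fun x _ => not_not.1 fun hx => h ⟨x, hx⟩)
  obtain ⟨ℓ, hℓ, hx1⟩ := exists_dual_vanishing_eq_one' N hx
  exact ⟨ℓ, hℓ, x, hx1⟩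

end Dual

section PiMap

variable {ι : Type u} {k : Type uk} [CommRing k] {V : ι → Type v} [∀ i, AddCommGroup (V i)]
  [∀ i, Module k (V i)] {x₀ : ∀ i, V i} {W : Type w} [AddCommGroup W] [Module k W] [DecidableEq ι]
  {j : RestrictedFamily V x₀ → W} {S₀ : Finset ι}

/-- Splitting `∏ᶠ_i c i` along a finset `S`. [folklore] -/
private theorem finprod_eq_prod_mul_finprod_ite' (c : ι → k) (hc : (mulSupport c).Finite) (S : Finset ι) :
    ∏ᶠ i, c i = (∏ i ∈ S, c i) * ∏ᶠ i, (if i ∈ S then 1 else c i) := by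
  classical
  have h1 : (mulSupport fun i => if i ∈ S then c i else 1) ⊆ ↑S := by
    intro i hi
    by_contra hiS
    exact hi (if_neg (fun h => hiS (Finset.mem_coe.2 h)))
  have h2 : (mulSupport fun i => if i ∈ S then (1 : k) else c i).Finite :=
    hc.subset fun i hi => by
      by_contra hci
      refine hi ?_
      show (if i ∈ S then (1 : k) else c i) = 1
      split_ifs
      · rfl
      · exact notMem_mulSupport.1 hci
  have hsplit : ∀ i, c i = (if i ∈ S then c i else 1) * (if i ∈ S then 1 else c i) := fun i => by
    split_ifs <;> simp
  calc ∏ᶠ i, c i = ∏ᶠ i, (if i ∈ S then c i else 1) * (if i ∈ S then 1 else c i) := finprod_congr hsplit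
    _ = (∏ᶠ i, if i ∈ S then c i else 1) * ∏ᶠ i, (if i ∈ S then 1 else c i) :=
        finprod_mul_distrib (hc.subset fun i hi => by
          by_contra hci
          refine hi ?_
          show (if i ∈ S then c i else 1) = 1
          split_ifs
          · exact notMem_mulSupport.1 hci
          · rfl) h2
    _ = (∏ i ∈ S, c i) * ∏ᶠ i, (if i ∈ S then 1 else c i) := by
        rw [finprod_eq_prod_of_mulSupport_subset _ h1]
        congr 1
        exact Finset.prod_congr rfl fun i hi => if_pos hi

/-- The factors of the retraction scalar have finite multiplicative support. [folklore] -/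
private theorem finite_mulSupport_retractionFactor' (ℓ : ∀ i, V i →ₗ[k] k) (hℓ : ∀ i ∉ S₀, ℓ i (x₀ i) = 1)
    (x : RestrictedFamily V x₀) :
    (mulSupport (RestrictedTensorProduct.retractionFactor S₀ ℓ (⇑x))).Finite := by
  obtain ⟨T, -, hT⟩ := RestrictedFamily.exists_finset_forall_apply_eq (∅ : Finset ι) ({x} : Finset _)
  exact (T.finite_toSet).subset
    (RestrictedTensorProduct.mulSupport_retractionFactor_subset hℓ x T (hT x (Finset.mem_singleton_self x)))

namespace IsRestrictedTensorProduct

/-- **Eigen-property of a product form under a coordinatewise operator.**  For a product form `Λ` of local forms `ℓ i`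
(`exists_prodDual`: `Λ (j x) = ∏_i ℓ i (x i)`) and a family of local operators `A i : V i → V i` fixing the base vectors
for almost all `i` (so that `A • x := RestrictedFamily.piMap A hA x` is again a restricted family), if
`ℓ i (A i v) = c i · ℓ i v` with `c i = 1` for almost all `i`, then `Λ (j (A • x)) = (∏_i c i) · Λ (j x)`.
(Flath 1979, §2: the forms `⊗ λ_v` and the maps `⊗ A_v`.) [cite: Flath1979, §2] -/
theorem prodDual_piMap_apply (h : IsRestrictedTensorProduct k j S₀) {ℓ : ∀ i, V i →ₗ[k] k}
    (hℓ : ∀ i ∉ S₀, ℓ i (x₀ i) = 1) {Λ : W →ₗ[k] k}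
    (hΛ : ∀ x : RestrictedFamily V x₀,
      Λ (j x) = (∏ᶠ i, RestrictedTensorProduct.retractionFactor S₀ ℓ (⇑x) i) * ∏ i : S₀, ℓ i (x i))
    (A : ∀ i, V i →ₗ[k] V i) (hA : ∀ᶠ i in cofinite, A i (x₀ i) = x₀ i) (c : ι → k)
    (hc : ∀ (i : ι) (v : V i), ℓ i (A i v) = c i * ℓ i v) (hfin : (mulSupport c).Finite)
    (x : RestrictedFamily V x₀) :
    Λ (j (RestrictedFamily.piMap A hA x)) = (∏ᶠ i, c i) * Λ (j x) := by
  classical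
  have _ := h
  rw [hΛ, hΛ]
  set c' : ι → k := fun i => if i ∈ S₀ then 1 else c i with hc'
  have hF : ∀ i, RestrictedTensorProduct.retractionFactor S₀ ℓ (⇑(RestrictedFamily.piMap A hA x)) i =
      c' i * RestrictedTensorProduct.retractionFactor S₀ ℓ (⇑x) i := by
    intro i
    simp only [RestrictedTensorProduct.retractionFactor, hc', RestrictedFamily.piMap_apply]
    split_ifs
    · rw [one_mul]
    · exact hc i (x i)
  have hc'fin : (mulSupport c').Finite := hfin.subset fun i hi => by
    by_contra hci
    refine hi ?_
    simp only [hc']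
    split_ifs
    · rfl
    · exact notMem_mulSupport.1 hci
  have hS : ∏ i : S₀, ℓ i (RestrictedFamily.piMap A hA x i) = (∏ i : S₀, c i) * ∏ i : S₀, ℓ i (x i) := by
    rw [← Finset.prod_mul_distrib]
    exact Finset.prod_congr rfl fun i _ => by rw [RestrictedFamily.piMap_apply, hc]
  rw [finprod_congr hF, finprod_mul_distrib hc'fin (finite_mulSupport_retractionFactor' ℓ hℓ x), hS,
    finprod_eq_prod_mul_finprod_ite' c hfin S₀, ← Finset.prod_coe_sort S₀ c]
  ring

/-- **Twisted coinvariants of a restricted tensor product are non-zero — operator form.**  Let a group `H` act on the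
model `W` of `⊗'_i (V i, x₀ i)` by `πH` so that each `h` acts on pure tensors coordinatewise through local operators
`A h i : V i → V i` fixing the base vectors for almost all `i` (`πH h (j x) = j (A h • x)`), and let `χ : H →* kˣ` with
`χ h = ∏_i c h i`.  Given local `A h i`-EIGENforms `ℓ i` with eigenvalues `c h i`, normalised by `ℓ i (x₀ i) = 1` off `S₀`
and taking the value `1` somewhere for `i ∈ S₀`, the `χ`-coinvariants `TwistedCoinv.Coinv πH χ = W ⧸ span {h·w − χ h • w}`
are a NON-ZERO space (the product form is `χ`-equivariant and non-zero and descends through `TwistedCoinv.lift`).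
[cite: Flath1979, §2] -/
theorem nontrivial_coinv_of_localEigenfunctionals_of_piMap [Nontrivial k] {H : Type uH} [Group H]
    (h : IsRestrictedTensorProduct k j S₀) (πH : Representation k H W) (A : H → ∀ i, V i →ₗ[k] V i)
    (hA : ∀ g : H, ∀ᶠ i in cofinite, A g i (x₀ i) = x₀ i)
    (hact : ∀ (g : H) (x : RestrictedFamily V x₀), πH g (j x) = j (RestrictedFamily.piMap (A g) (hA g) x))
    (χ : H →* kˣ) (ℓ : ∀ i, V i →ₗ[k] k) (hℓ : ∀ i ∉ S₀, ℓ i (x₀ i) = 1) (hℓ1 : ∀ i ∈ S₀, ∃ v : V i, ℓ i v = 1)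
    (c : H → ι → k) (hc : ∀ (g : H) (i : ι) (v : V i), ℓ i (A g i v) = c g i * ℓ i v)
    (hfin : ∀ g : H, (mulSupport (c g)).Finite) (hχ : ∀ g : H, ((χ g : kˣ) : k) = ∏ᶠ i, c g i) :
    Nontrivial (Literature.RepresentationTheory.TwistedCoinv.Coinv πH χ) := by
  obtain ⟨Λ, hΛ⟩ := h.exists_prodDual ℓ hℓ
  have hΛχ : ∀ (g : H) (w : W), Λ (πH g w) = ((χ g : kˣ) : k) • Λ w := fun g => by
    suffices hmaps : Λ ∘ₗ πH g = ((χ g : kˣ) : k) • Λ from fun w => by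
      simpa using LinearMap.congr_fun hmaps w
    refine h.linearMap_ext fun x => ?_
    rw [LinearMap.comp_apply, LinearMap.smul_apply, hact g x,
      h.prodDual_piMap_apply hℓ hΛ (A g) (hA g) (c g) (hc g) (hfin g) x, hχ g, smul_eq_mul]
  have hL : Literature.RepresentationTheory.TwistedCoinv.lift πH χ Λ hΛχ ≠ 0 := by
    rw [Ne, Literature.RepresentationTheory.TwistedCoinv.lift_eq_zero_iff]
    exact prodDual_ne_zero hℓ hℓ1 hΛ
  by_contra hnt
  rw [not_nontrivial_iff_subsingleton] at hnt
  exact hL (LinearMap.ext fun y => by rw [Subsingleton.elim y 0, map_zero, LinearMap.zero_apply])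

/-- **The same with the local input through submodules** (local «augmentations»), over a field: `N i ≤ V i` containing
every `A g i v − c g i • v`, with `V i ⧸ N i ≠ 0` for `i ∈ S₀` (LOCAL NON-VANISHING) and `x₀ i ∉ N i` for `i ∉ S₀` (the
base vector survives in the local quotient); `χ g = ∏_i c g i`.  Then `TwistedCoinv.Coinv πH χ` is non-trivial.
[cite: Flath1979, §2] -/
theorem nontrivial_coinv_of_localQuotients_of_piMap {k : Type uk} [Field k] [∀ i, Module k (V i)] [Module k W]
    {j : RestrictedFamily V x₀ → W} {H : Type uH} [Group H]
    (h : IsRestrictedTensorProduct k j S₀) (πH : Representation k H W) (A : H → ∀ i, V i →ₗ[k] V i)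
    (hA : ∀ g : H, ∀ᶠ i in cofinite, A g i (x₀ i) = x₀ i)
    (hact : ∀ (g : H) (x : RestrictedFamily V x₀), πH g (j x) = j (RestrictedFamily.piMap (A g) (hA g) x))
    (χ : H →* kˣ) (N : ∀ i, Submodule k (V i)) (c : H → ι → k)
    (hN : ∀ (g : H) (i : ι) (v : V i), A g i v - c g i • v ∈ N i)
    (hS₀ : ∀ i ∈ S₀, N i ≠ ⊤) (hx₀N : ∀ i ∉ S₀, x₀ i ∉ N i)
    (hfin : ∀ g : H, (mulSupport (c g)).Finite) (hχ : ∀ g : H, ((χ g : kˣ) : k) = ∏ᶠ i, c g i) :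
    Nontrivial (Literature.RepresentationTheory.TwistedCoinv.Coinv πH χ) := by
  classical
  have hloc : ∀ i, ∃ ℓ : V i →ₗ[k] k, (∀ n ∈ N i, ℓ n = 0) ∧ (i ∉ S₀ → ℓ (x₀ i) = 1) ∧ ∃ v, ℓ v = 1 := by
    intro i
    by_cases hi : i ∈ S₀
    · obtain ⟨ℓ, hℓN, v, hv⟩ := exists_dual_vanishing_of_ne_top' (N i) (hS₀ i hi)
      exact ⟨ℓ, hℓN, fun h => (h hi).elim, v, hv⟩
    · obtain ⟨ℓ, hℓN, h1⟩ := exists_dual_vanishing_eq_one' (N i) (hx₀N i hi)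
      exact ⟨ℓ, hℓN, fun _ => h1, x₀ i, h1⟩
  choose ℓ hℓN hℓ1 hℓv using hloc
  refine h.nontrivial_coinv_of_localEigenfunctionals_of_piMap πH A hA hact χ ℓ hℓ1 (fun i _ => hℓv i) c
    (fun g i v => ?_) hfin hχ
  have h0 := hℓN i _ (hN g i v)
  rwa [map_sub, map_smul, smul_eq_mul, sub_eq_zero] at h0

end IsRestrictedTensorProduct

/-! ### Non-vacuity of the hypothesis set (kernel certificate) -/

/-- **The hypotheses of `nontrivial_coinv_of_localQuotients_of_piMap` are jointly inhabited**: one factor `V := k`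
(index `PUnit`), base vector `1`, the tree's constructed model `(RestrictedTensorProduct k x₀, ⊗')` with exceptional set
`∅` (`RestrictedTensorProduct.isRestrictedTensorProductRep` over the trivial groups), `H := PUnit` acting trivially
(`A := id`), `χ := 1`, `N := ⊥`, `c := 1`.  Our bookkeeping. [cite: Flath1979, §2] -/
theorem nontrivial_coinv_of_localQuotients_of_piMap_inhabited (k : Type uk) [Field k] :
    Nontrivial (Literature.RepresentationTheory.TwistedCoinv.Coinv
      (1 : Representation k PUnit.{uH + 1} (RestrictedTensorProduct k (fun _ : PUnit.{u + 1} => (1 : k))))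
      (1 : PUnit.{uH + 1} →* kˣ)) := by
  classical
  let ρ : ∀ _ : PUnit.{u + 1}, Representation k PUnit.{1} k := fun _ => 1
  have hx₀ : ∀ᶠ i in cofinite, (fun _ : PUnit.{u + 1} => (1 : k)) i ∈
      (ρ i).fixedPoints ((fun _ => (⊤ : Subgroup PUnit.{1})) i) :=
    Eventually.of_forall fun i => by simp [ρ]
  have hπ := RestrictedTensorProduct.isRestrictedTensorProductRep (K := fun _ => (⊤ : Subgroup PUnit.{1}))
    (x₀ := fun _ : PUnit.{u + 1} => (1 : k)) ρ ∅ hx₀ (fun _ _ => one_ne_zero)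
  have hA : ∀ _ : PUnit.{uH + 1}, ∀ᶠ i in cofinite,
      (fun _ : PUnit.{u + 1} => (LinearMap.id : k →ₗ[k] k)) i ((fun _ : PUnit.{u + 1} => (1 : k)) i) =
        (fun _ : PUnit.{u + 1} => (1 : k)) i :=
    fun _ => Eventually.of_forall fun _ => rfl
  refine hπ.isRestrictedTensorProduct.nontrivial_coinv_of_localQuotients_of_piMap 1
    (fun _ _ => LinearMap.id) hA (fun g x => ?_) 1 (fun _ => ⊥) (fun _ _ => 1) (fun g i v => ?_)
    (fun i hi => (Finset.notMem_empty i hi).elim) (fun i _ => ?_) (fun _ => ?_) (fun _ => ?_)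
  · have hx : RestrictedFamily.piMap (fun _ : PUnit.{u + 1} => (LinearMap.id : k →ₗ[k] k)) (hA g) x = x := by
      ext i; rfl
    rw [hx, MonoidHom.one_apply, Module.End.one_apply]
  · simp
  · simp
  · simp
  · simp

end PiMap

end Literature.NumberTheory.Automorphic

end
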